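import Summits.QuantumFields.YangMills.Theorems.LuscherReductionDressedRitzLiftLeakageResidual
import Summits.QuantumFields.YangMills.Theorems.DressedRitz.Negative.LeakageMixtureHazard
import Summits.QuantumFields.YangMills.Theorems.FemtoTransferGapGroundState
import HarnessLib

/-!
# Crux `DressedRitz` (stmt-QuantumFields-20205), line «polyakovlift», stub S-LEAK `stub_liftLeakage` — support V:
# the reference family of Part IV has a WINDOW-UNIFORM length (so `2Nρ` is an admissible constant of the stub)

Support module (fleet seat ym-20205-polyakovlift-s1; `--supports stmt-QuantumFields-20205`, helper, no closure claim).  Part IV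
(`…LiftLeakageAllBases.lean`, `LiftLeak.residualLaw_allBases_of_reference`) reduces the `∀`-basis residual law of S-LEAK at a fixed lattice
`(L, β)` to data on ONE reference one-site eigenfamily `ψ_0 … ψ_{N−1}` at the lift coupling `B₁ = liftCoupling β L = 2/λ³` dominating at a level
`Λ = μ_N(B₁) < μ_k(B₁)`, with the constant `2Nρ`.  For the stub (whose constant `C` is chosen per `k` BEFORE the window) `N` must not drift with
`(L, β)`.  This file proves it does not, from two CLOSED inputs of the tree: the discreteness of Lüscher's matrix model
(`YMMatrixModel.tendsto_physLevel_atTop`, Simon 1983: `Δ_k = levelGap k → ∞`) and the disprover's corollary of the closed crux ONE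
(`PolyakovLift.Negative.oneSite_levelValue_lt_of_levelGap_lt`: distinct `𝔥`-gaps are eventually strictly ordered one-site levels).

* `exists_levelGap_lt k`: some `N` has `levelGap k < levelGap N` (an index beyond the `𝔥`-shell of level `k`);
* ★ `exists_uniform_reference_index k`: `∃ N lam0 > 0, ∀ lam ∈ (0, lam0], ∀ L β, InFemtoWindow lam β L → μ_N(B₁) < μ_k(B₁)` — deep in the femto
  window the lift coupling `B₁ = 2/λ³ ≥ 1/(4·lam0³)` exceeds ONE's threshold;
* ★★ `exists_reference_uniform k`: with THAT `N`, throughout the window the tree supplies the reference data of Part IV at `B₁`: a positive raw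
  one-site vacuum `Ω₁`, an exact physical orthonormal eigenfamily `ψ : Fin N → …` with levels `μ_n(B₁)`, dominating at `μ_N(B₁) < μ_k(B₁)`.
  Consequently the RG prover owes, per `k`, ONE window-uniform `N = N(k)` and the two estimates (RL) (cluster-constant reference residual law with
  `ρ = C(λ³/L²)λ₀²/(2N)`) and (GR) (in-cluster Gram control) of Part IV — nothing else — for `LiftLeak.liftLeakage_of_vacuumResidualLaw` to close
  the registered stub.

HONEST FRAMING: fixed-lattice ∕ one-site bookkeeping on the conditional femto rung R2b1; (RL) and (GR) stay OPEN RG estimates; the stub stays OPEN;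
nothing here bears on infinite volume, the continuum limit or the Clay gap.  References: B. Simon, Ann. Phys. 146 (1983) 209
[cite: SimonB1983DiscreteSpectrum, Cor. 4]; M. Lüscher, NPB 219 (1983) 233 [cite: Luscher1983, §3]; Reed–Simon IV Thm XIII.1 [cite: ReedSimonIV1978].
-/

set_option autoImplicit false

noncomputable section

open MeasureTheory Filter Topology Real Finset
open Literature.MathematicalPhysics.QuantumFieldTheory (GaugeConfig Site gaugeTransform)
open Literature.Analysis.OperatorTheory.YMMatrixModel
open scoped BigOperators

namespace Summit.QuantumFields.YangMills.Theorems.FemtoTransferGap.LiftLeak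

open Summit.QuantumFields.YangMills.Theorems.FemtoTransferGap
open Summit.QuantumFields.YangMills.Theorems.FemtoTransferGap.PhysL2
open Summit.QuantumFields.YangMills.Theorems.FemtoTransferGap.PolyakovLift
open Summit.QuantumFields.YangMills.Theorems.FemtoTransferGap.PolyakovLift.Negative

/-- **Beyond every `𝔥`-shell there is a level with a strictly larger gap** (`Δ_k = physLevel (k+1) − physLevel 1 → ∞`, discreteness of Lüscher's
matrix model). [cite: SimonB1983DiscreteSpectrum, Cor. 4] -/
theorem exists_levelGap_lt (k : ℕ) : ∃ N : ℕ, levelGap k < levelGap N := by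
  have h : Tendsto (fun n : ℕ => physLevel (n + 1)) atTop atTop := tendsto_physLevel_atTop.comp (tendsto_add_atTop_nat 1)
  obtain ⟨N, hN⟩ := (h.eventually (eventually_gt_atTop (physLevel (k + 1)))).exists
  refine ⟨N, ?_⟩
  unfold levelGap
  linarith

/-- ★ **Window-uniform separation index.**  For every `k` there are `N` and `lam0 > 0` such that, for every level `0 < lam ≤ lam0` and EVERY
`(L, β)` in the femto window, the `N`-th one-site level at the lift coupling lies STRICTLY below the `k`-th: `μ_N(B₁) < μ_k(B₁)`, `B₁ = 2/λ³`.
(`levelGap k < levelGap N` by discreteness; ONE's ordering threshold `B₀` from `oneSite_levelValue_lt_of_levelGap_lt`; in the window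
`λ ≤ 2·lam ≤ 1` so `B₁ = 2/λ³ ≥ 2/λ ≥ 4·max(B₀,1)`.) [cite: Luscher1983, §3] [cite: SimonB1983DiscreteSpectrum, Cor. 4] -/
theorem exists_uniform_reference_index (k : ℕ) :
    ∃ (N : ℕ) (lam0 : ℝ), 0 < lam0 ∧ ∀ lam : ℝ, 0 < lam → lam ≤ lam0 → ∀ (L : ℕ) (β : ℝ), InFemtoWindow lam β L →
      levelValue su2Rep 1 (liftCoupling β L) N < levelValue su2Rep 1 (liftCoupling β L) k := by
  obtain ⟨N, hN⟩ := exists_levelGap_lt k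
  obtain ⟨B0, hB0⟩ := oneSite_levelValue_lt_of_levelGap_lt hN
  set M₀ : ℝ := max B0 1 with hM₀
  have hM₀pos : 0 < M₀ := lt_of_lt_of_le one_pos (le_max_right _ _)
  refine ⟨N, min (1 / 2) (1 / (4 * M₀)), lt_min (by norm_num) (by positivity), fun lam hlam hle L β hW => ?_⟩
  have hlpos : 0 < luscherLambda β L := luscherLambda_pos_of_window hlam hW
  have hlle : luscherLambda β L ≤ 2 * lam := hW.2.2
  have hlam_half : lam ≤ 1 / 2 := hle.trans (min_le_left _ _)
  have hlam_M : lam ≤ 1 / (4 * M₀) := hle.trans (min_le_right _ _)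
  have hl1 : luscherLambda β L ≤ 1 := by linarith
  -- `λ³ ≤ λ ≤ 2·lam ≤ 1/(2M₀)`
  have hcube : luscherLambda β L ^ 3 ≤ 1 / (2 * M₀) := by
    have h1 : luscherLambda β L ^ 3 ≤ luscherLambda β L ^ 1 := pow_le_pow_of_le_one hlpos.le hl1 (by norm_num)
    rw [pow_one] at h1
    have h2 : 2 * lam ≤ 1 / (2 * M₀) := by
      have : 2 * (1 / (4 * M₀)) = 1 / (2 * M₀) := by field_simp; ring
      linarith [mul_le_mul_of_nonneg_left hlam_M (by norm_num : (0 : ℝ) ≤ 2)]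
    linarith
  have hB : B0 ≤ liftCoupling β L := by
    unfold liftCoupling
    have h3 : 2 / (1 / (2 * M₀)) ≤ 2 / luscherLambda β L ^ 3 :=
      div_le_div_of_nonneg_left (by norm_num) (pow_pos hlpos 3) hcube
    have h4 : 2 / (1 / (2 * M₀)) = 4 * M₀ := by field_simp; ring
    rw [h4] at h3
    have h5 : B0 ≤ M₀ := le_max_left _ _
    linarith
  exact hB0 _ hB

/-- ★★ **Window-uniform reference data for Part IV.**  For every `k` there are `N` and `lam0 > 0` such that throughout the femto window
(`0 < lam ≤ lam0`, `InFemtoWindow lam β L`), at the lift coupling `B₁ = liftCoupling β L`, the tree supplies the reference data of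
`LiftLeak.residualLaw_allBases_of_reference` with THIS `N`: a positive raw one-site vacuum `Ω₁`, an exact physical `l2`-orthonormal eigenfamily
`ψ_0 … ψ_{N−1}` with levels `μ_n(B₁)`, and Courant–Fischer domination at `Λ = μ_N(B₁)` with `0 ≤ Λ < μ_k(B₁)`.  So the constant `2Nρ` of Part IV is a
legitimate `k`-dependent constant of the stub. [cite: ReedSimonIV1978, Thm XIII.1 and Thm XIII.43] [cite: Luscher1983, §3] -/
theorem exists_reference_uniform (k : ℕ) :
    ∃ (N : ℕ) (lam0 : ℝ), 0 < lam0 ∧ ∀ lam : ℝ, 0 < lam → lam ≤ lam0 → ∀ (L : ℕ) (β : ℝ), InFemtoWindow lam β L →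
      ∃ (Ω₁ : GaugeConfig 3 1 SU2 → ℝ) (ψ : Fin N → (GaugeConfig 3 1 SU2 → ℝ)),
        IsRawVacuum (liftCoupling β L) Ω₁ ∧ (∃ c : ℝ, 0 < c ∧ ∀ V, c ≤ Ω₁ V) ∧ (∀ n, IsPhys (ψ n)) ∧
        (∀ n m, l2 (ψ n) (ψ m) = if n = m then 1 else 0) ∧
        (∀ n : Fin N, transferApply (liftCoupling β L) (ψ n) = levelValue su2Rep 1 (liftCoupling β L) n • ψ n) ∧
        0 ≤ levelValue su2Rep 1 (liftCoupling β L) N ∧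
        levelValue su2Rep 1 (liftCoupling β L) N < levelValue su2Rep 1 (liftCoupling β L) k ∧
        ∀ χ : GaugeConfig 3 1 SU2 → ℝ, IsPhys χ → (∀ n, l2 χ (ψ n) = 0) →
          l2 χ (transferApply (liftCoupling β L) χ) ≤ levelValue su2Rep 1 (liftCoupling β L) N * l2 χ χ := by
  obtain ⟨N, lam0, hlam0, hsep⟩ := exists_uniform_reference_index k
  refine ⟨N, lam0, hlam0, fun lam hlam hle L β hW => ?_⟩
  have hlpos : 0 < luscherLambda β L := luscherLambda_pos_of_window hlam hW
  have hB : 0 < liftCoupling β L := by unfold liftCoupling; exact div_pos two_pos (pow_pos hlpos 3)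
  obtain ⟨ψ, hψ, hon, heig, hdom⟩ := exists_eigenfamily_dominating (L := 1) hB N
  obtain ⟨Ω, θ, c, hΩ, hc, hcle, hn, heigΩ, -, -, -⟩ := exists_groundState (L := 1) (liftCoupling β L)
  exact ⟨Ω, ψ, ⟨hΩ, hn, by rw [levelValue_zero]; exact heigΩ⟩, ⟨c, hc, hcle⟩, hψ, hon, heig,
    levelValue_su2Rep_nonneg 1 hB.le N, hsep lam hlam hle L β hW, hdom⟩

end Summit.QuantumFields.YangMills.Theorems.FemtoTransferGap.LiftLeak

end
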